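import Summits.BirchSwinnertonDyer.Rank1Residual.P2.DecompositionsThreePrimes
import Summits.BirchSwinnertonDyer.Rank1Residual.P2.CongruentNumberPairsAtTwoPrimeSevenModEight
import HarnessLib

/-!
# Sub-lane «bsd-p2»: TYZ decompositions FIBRED OVER THE BLOCK OF A PRIME — the generic bookkeeping
# behind every `k`-block genus sum, and the fifteen decompositions of `q·a·b·c` (four distinct primes)

HONEST FRAMING (sub-lane «bsd-p2», run/shared/lean/b2b/bsd-rank1-residual/p2/, verbatim in every
file): the target of record is the FULL Birch–Swinnerton-Dyer formula for EVERY analytic-rank `≤ 1`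
`E/ℚ` at ALL primes INCLUDING `2`; the odd-prime class ledger is referee A's; the `2`-part is OPEN
(cells O1 = X5 ∖ CM and O12 = the CM corner) and under census by «bsd-p2». Census / instrument
output at `2` = EVIDENCE / conjecture items with held-out validation, NEVER a Literature fact;
certificates close PAIRS (one isogeny class, `p = 2`), never classes. This file asserts NO
arithmetic fact about any curve: it is finite-set bookkeeping about Tian–Yuan–Zhang's non-ordered
decompositions `n = d₀d₁⋯d_ℓ` (`decompositions n`, lit-1's `TianYuanZhang2017/GenusPeriodsParity.lean`).

WHAT IT DOES. monsky-lit's `DecompositionsThreePrimes.lean` lists the five decompositions of a product of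
THREE distinct primes by an explicit case analysis; the even `ω(m) = 3` atlas (`n = 2·p₀p₁p₂`) and any
`k = 4` statement need FOUR prime factors (fifteen decompositions), where a case analysis explodes.
§1 proves the generic recursion instead: for a prime `p ∣ n`, every decomposition of `n` has EXACTLY ONE
block divisible by `p` (blocks are pairwise coprime), that block is `p·e` with `e ∣ n/p`, and erasing /
inserting it is a bijection with the decompositions of `n/(pe)` (`n` square-free); hence
`Σ_{D ∈ dec n} F D = Σ_{e ∣ n/p} Σ_{D′ ∈ dec (n/(pe))} F (insert (pe) D′)` (`sum_decompositions_fibre`).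
§2 reads off `decompositions 1 = {∅}`, the two decompositions of `a·b` (with the landed `decompositions_prime`), and —
from the LANDED `sum_decompositions_three` — the FIFTEEN-term closed form `sum_decompositions_four` for
`q·a·b·c` (`q, a, b, c` distinct primes; `q = 2` is the even three-prime case). Nothing here mentions a
residue, a symbol or a curve; nothing booked; no mark moved. Unit `b2b-bsdres-p2-typer` GEN 23;
scratch (NOT proposed — rails T-149 (e) / T-155 (o)).

References: [TianYuanZhang2017] Thm 1.1 / Thm 1.2 ("all decompositions `n = d₀⋯d_ℓ` are non-ordered
with `dᵢ > 1`"); [HardyWright2008] §1.3 Thm 2 (unique factorisation: the divisors of a square-free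
number and the coprimality of complementary divisors).
-/

open Finset Literature.NumberTheory.EllipticCurves.TianYuanZhang2017

set_option autoImplicit false

namespace Summit.BirchSwinnertonDyer.Rank1Residual.P2

/-! ## §1 The fibre of a prime: erase / insert -/

section Fibre

/-- Membership in `decompositions n`, unfolded: a set of divisors `> 1` of `n`, pairwise coprime,
with product `n`. [cite: TianYuanZhang2017, Thm. 1.1 ("non-ordered decompositions n = d₀⋯d_ℓ with dᵢ > 1")] -/
theorem mem_decompositions_iff {n : ℕ} {D : Finset ℕ} :
    D ∈ decompositions n ↔ D ⊆ n.divisors ∧ (∀ d ∈ D, 1 < d) ∧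
      (D : Set ℕ).Pairwise Nat.Coprime ∧ ∏ d ∈ D, d = n := by
  simp only [decompositions, Finset.mem_filter, Finset.mem_powerset]

/-- Only non-zero `n` have decompositions (`decompositions 0 = ∅`: the empty product is `1`).
[cite: TianYuanZhang2017, Thm. 1.1 (decompositions have product n)] -/
theorem ne_zero_of_mem_decompositions {n : ℕ} {D : Finset ℕ} (hD : D ∈ decompositions n) : n ≠ 0 := by
  rintro rfl
  rw [mem_decompositions_iff] at hD
  obtain ⟨hsub, -, -, hprod⟩ := hD
  have hD0 : D = ∅ := Finset.subset_empty.mp (by simpa [Nat.divisors_zero] using hsub)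
  rw [hD0, Finset.prod_empty] at hprod
  exact one_ne_zero hprod

/-- **Erasing a block.** If `x` is a block of a decomposition `D` of `n`, then `D ∖ {x}` is a
decomposition of `n / x`. [cite: TianYuanZhang2017, Thm. 1.1 (decompositions)] [cite: HardyWright2008, §1.3 Thm. 2] -/
theorem erase_mem_decompositions {n x : ℕ} {D : Finset ℕ} (hD : D ∈ decompositions n) (hx : x ∈ D) :
    D.erase x ∈ decompositions (n / x) := by
  rw [mem_decompositions_iff] at hD ⊢
  obtain ⟨-, h1, hcop, hprod⟩ := hD
  have hx0 : 0 < x := lt_trans zero_lt_one (h1 x hx)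
  have hprod' : ∏ d ∈ D.erase x, d = n / x := by
    rw [← hprod, ← Finset.mul_prod_erase D (fun d => d) hx, Nat.mul_div_cancel_left _ hx0]
  have hnx : n / x ≠ 0 := by
    rw [← hprod']
    exact Finset.prod_ne_zero_iff.mpr fun d hd =>
      (lt_trans zero_lt_one (h1 d (Finset.mem_of_mem_erase hd))).ne'
  refine ⟨fun d hd => Nat.mem_divisors.mpr ⟨hprod' ▸ Finset.dvd_prod_of_mem (fun d => d) hd, hnx⟩,
    fun d hd => h1 d (Finset.mem_of_mem_erase hd),
    hcop.mono (Finset.coe_subset.mpr (Finset.erase_subset x D)), hprod'⟩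

/-- **Inserting a block.** If `D` is a decomposition of `m ≠ 0` and `x > 1` is coprime to `m`, then
`D ∪ {x}` is a decomposition of `x·m`. [cite: TianYuanZhang2017, Thm. 1.1 (decompositions)] [cite: HardyWright2008, §1.3 Thm. 2] -/
theorem insert_mem_decompositions {m x : ℕ} {D : Finset ℕ} (hD : D ∈ decompositions m) (hx : 1 < x)
    (hcop : Nat.Coprime x m) : insert x D ∈ decompositions (x * m) := by
  have hm := ne_zero_of_mem_decompositions hD
  rw [mem_decompositions_iff] at hD ⊢
  obtain ⟨hsub, h1, hpair, hprod⟩ := hD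
  have hdvd : ∀ d ∈ D, d ∣ m := fun d hd => Nat.dvd_of_mem_divisors (hsub hd)
  have hxD : x ∉ D := fun hxD => hx.ne' (Nat.Coprime.eq_one_of_dvd hcop (hdvd x hxD))
  have hxm : x * m ≠ 0 := mul_ne_zero (by omega) hm
  refine ⟨fun d hd => ?_, fun d hd => ?_, ?_, ?_⟩
  · rw [Finset.mem_insert] at hd
    rcases hd with rfl | hd
    · exact Nat.mem_divisors.mpr ⟨dvd_mul_right _ _, hxm⟩
    · exact Nat.mem_divisors.mpr ⟨dvd_mul_of_dvd_right (hdvd d hd) x, hxm⟩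
  · rw [Finset.mem_insert] at hd
    rcases hd with rfl | hd
    · exact hx
    · exact h1 d hd
  · rw [Finset.coe_insert]
    refine hpair.insert fun d hd _ => ?_
    have h : Nat.Coprime x d := Nat.Coprime.coprime_dvd_right (hdvd d hd) hcop
    exact ⟨h, h.symm⟩
  · rw [Finset.prod_insert hxD, hprod]

/-- A prime divisor of `n` divides some block of every decomposition of `n` (the product of the
blocks is `n`). [cite: TianYuanZhang2017, Thm. 1.1 (decompositions have product n)] [cite: HardyWright2008, §1.3 Thm. 2] -/
theorem exists_mem_dvd_of_mem_decompositions {n p : ℕ} {D : Finset ℕ} (hD : D ∈ decompositions n)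
    (hp : p.Prime) (hpn : p ∣ n) : ∃ x ∈ D, p ∣ x := by
  rw [mem_decompositions_iff] at hD
  rw [← hD.2.2.2] at hpn
  exact (Nat.Prime.prime hp).exists_mem_finset_dvd hpn

/-- … and that block is UNIQUE: two blocks divisible by the same prime coincide (blocks are pairwise
coprime). [cite: TianYuanZhang2017, Thm. 1.1 (decompositions: pairwise coprime blocks)] -/
theorem eq_of_dvd_of_dvd_of_mem_decompositions {n p x y : ℕ} {D : Finset ℕ}
    (hD : D ∈ decompositions n) (hp : p.Prime) (hx : x ∈ D) (hy : y ∈ D) (hpx : p ∣ x)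
    (hpy : p ∣ y) : x = y := by
  by_contra hne
  have hcop : Nat.Coprime x y :=
    (mem_decompositions_iff.mp hD).2.2.1 (Finset.mem_coe.mpr hx) (Finset.mem_coe.mpr hy) hne
  have h1 : p ∣ 1 := by
    have h := Nat.dvd_gcd hpx hpy
    rwa [Nat.Coprime.gcd_eq_one hcop] at h
  exact hp.one_lt.ne' (Nat.dvd_one.mp h1)

/-- **The decompositions containing a given block `x`** (`1 < x ∣ n`, `x` coprime to `n/x`) are in
bijection with the decompositions of `n/x` by erasing / inserting `x`.
[cite: TianYuanZhang2017, Thm. 1.1 (decompositions)] [cite: HardyWright2008, §1.3 Thm. 2] -/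
theorem sum_decompositions_filter_mem {M : Type*} [AddCommMonoid M] {n x : ℕ} (hx : 1 < x)
    (hxn : x ∣ n) (hcop : Nat.Coprime x (n / x)) (F : Finset ℕ → M) :
    ∑ D ∈ (decompositions n).filter (fun D => x ∈ D), F D =
      ∑ D ∈ decompositions (n / x), F (insert x D) := by
  refine Finset.sum_nbij' (fun D => D.erase x) (fun D => insert x D) ?_ ?_ ?_ ?_ ?_
  · intro D hD
    rw [Finset.mem_filter] at hD
    exact erase_mem_decompositions hD.1 hD.2
  · intro D hD
    rw [Finset.mem_filter]
    refine ⟨?_, Finset.mem_insert_self x D⟩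
    have h := insert_mem_decompositions hD hx hcop
    rwa [Nat.mul_div_cancel' hxn] at h
  · intro D hD
    rw [Finset.mem_filter] at hD
    exact Finset.insert_erase hD.2
  · intro D hD
    have hxD : x ∉ D := fun hxD => hx.ne' (Nat.Coprime.eq_one_of_dvd hcop
      (Nat.dvd_of_mem_divisors ((mem_decompositions_iff.mp hD).1 hxD)))
    exact Finset.erase_insert hxD
  · intro D hD
    rw [Finset.mem_filter] at hD
    rw [Finset.insert_erase hD.2]

/-- **Fibration by the block of `p`.** For a prime `p ∣ n ≠ 0`, the decompositions of `n` are the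
disjoint union, over `e ∣ n/p`, of those containing the block `p·e`.
[cite: TianYuanZhang2017, Thm. 1.1 (decompositions)] [cite: HardyWright2008, §1.3 Thm. 2] -/
theorem decompositions_eq_biUnion {n p : ℕ} (hp : p.Prime) (hpn : p ∣ n) (hn : n ≠ 0) :
    decompositions n =
      (n / p).divisors.biUnion fun e => (decompositions n).filter fun D => p * e ∈ D := by
  ext D
  simp only [Finset.mem_biUnion, Finset.mem_filter, Nat.mem_divisors]
  constructor
  · intro hD
    obtain ⟨x, hxD, hpx⟩ := exists_mem_dvd_of_mem_decompositions hD hp hpn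
    obtain ⟨e, rfl⟩ := hpx
    have hxn : p * e ∣ n := Nat.dvd_of_mem_divisors ((mem_decompositions_iff.mp hD).1 hxD)
    refine ⟨e, ⟨?_, (Nat.div_pos (Nat.le_of_dvd (Nat.pos_of_ne_zero hn) hpn) hp.pos).ne'⟩, hD, hxD⟩
    obtain ⟨t, ht⟩ := hxn
    exact ⟨t, by rw [ht, mul_assoc, Nat.mul_div_cancel_left _ hp.pos]⟩
  · rintro ⟨e, -, hD, -⟩
    exact hD

/-- The fibres over distinct `e ∣ n/p` are disjoint (a decomposition has ONE block divisible by `p`).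
[cite: TianYuanZhang2017, Thm. 1.1 (decompositions: pairwise coprime blocks)] -/
theorem pairwiseDisjoint_decompositions_filter {n p : ℕ} (hp : p.Prime) :
    ((n / p).divisors : Set ℕ).PairwiseDisjoint
      fun e => (decompositions n).filter fun D => p * e ∈ D := by
  intro e _ e' _ hne
  simp only [Function.onFun, Finset.disjoint_left]
  intro D hD hD'
  rw [Finset.mem_filter] at hD hD'
  have heq := eq_of_dvd_of_dvd_of_mem_decompositions hD.1 hp hD.2 hD'.2 (dvd_mul_right p e)
    (dvd_mul_right p e')
  exact hne (Nat.eq_of_mul_eq_mul_left hp.pos heq)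

/-- **Sum over decompositions, fibred over the block of a prime.** For square-free `n` and a prime
`p ∣ n`: `Σ_{D ∈ dec n} F D = Σ_{e ∣ n/p} Σ_{D′ ∈ dec (n/(pe))} F (insert (pe) D′)` — the block of `p`
is `p·e`, the rest is a decomposition of `n/(pe)`. The generic recursion behind every closed form of a
genus sum over a prime tuple (three primes: five terms; four: fifteen; five: fifty-two).
[cite: TianYuanZhang2017, Thm. 1.1 / Thm. 1.2 (sums over non-ordered decompositions)] [cite: HardyWright2008, §1.3 Thm. 2] -/
theorem sum_decompositions_fibre {M : Type*} [AddCommMonoid M] {n p : ℕ} (hn : Squarefree n)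
    (hp : p.Prime) (hpn : p ∣ n) (F : Finset ℕ → M) :
    ∑ D ∈ decompositions n, F D =
      ∑ e ∈ (n / p).divisors, ∑ D ∈ decompositions (n / (p * e)), F (insert (p * e) D) := by
  have hn0 : n ≠ 0 := hn.ne_zero
  rw [decompositions_eq_biUnion hp hpn hn0,
    Finset.sum_biUnion (pairwiseDisjoint_decompositions_filter hp)]
  refine Finset.sum_congr rfl fun e he => ?_
  have he' : e ∣ n / p := Nat.dvd_of_mem_divisors he
  have hpe : p * e ∣ n := by
    have h := Nat.mul_dvd_mul_left p he'
    rwa [Nat.mul_div_cancel' hpn] at h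
  have h1 : 1 < p * e := lt_of_lt_of_le hp.one_lt (Nat.le_mul_of_pos_right p (Nat.pos_of_mem_divisors he))
  have hcop : Nat.Coprime (p * e) (n / (p * e)) := by
    have hsq : Squarefree ((p * e) * (n / (p * e))) := by rwa [Nat.mul_div_cancel' hpe]
    exact (Nat.squarefree_mul_iff.mp hsq).1
  exact sum_decompositions_filter_mem h1 hpe hcop F

/-- **Divisors of `p·m`, `p` prime, `p ∤ m`**: `e` or `p·e` with `e ∣ m`; as a sum identity.
[cite: HardyWright2008, §1.3 Thm. 2 (divisors of a product of coprime numbers)] -/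
theorem sum_divisors_prime_mul {M : Type*} [AddCommMonoid M] {p m : ℕ} (hp : p.Prime)
    (hpm : ¬ p ∣ m) (hm : m ≠ 0) (G : ℕ → M) :
    ∑ e ∈ (p * m).divisors, G e = ∑ e ∈ m.divisors, (G e + G (p * e)) := by
  have hsplit : (p * m).divisors = m.divisors ∪ m.divisors.image (p * ·) := by
    ext e
    simp only [Finset.mem_union, Finset.mem_image, Nat.mem_divisors]
    constructor
    · rintro ⟨he, -⟩
      obtain ⟨e₁, e₂, he₁, he₂, rfl⟩ := dvd_mul.mp he
      rcases (Nat.dvd_prime hp).mp he₁ with rfl | rfl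
      · exact Or.inl ⟨by simpa using he₂, hm⟩
      · exact Or.inr ⟨e₂, ⟨he₂, hm⟩, rfl⟩
    · rintro (⟨he, -⟩ | ⟨e₂, ⟨he₂, -⟩, rfl⟩)
      · exact ⟨dvd_mul_of_dvd_right he p, mul_ne_zero hp.ne_zero hm⟩
      · exact ⟨Nat.mul_dvd_mul_left p he₂, mul_ne_zero hp.ne_zero hm⟩
  have hdisj : Disjoint m.divisors (m.divisors.image (p * ·)) := by
    rw [Finset.disjoint_left]
    intro e he he'
    rw [Finset.mem_image] at he'
    obtain ⟨e₂, -, rfl⟩ := he'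
    exact hpm (dvd_trans (dvd_mul_right p e₂) (Nat.dvd_of_mem_divisors he))
  rw [hsplit, Finset.sum_union hdisj,
    Finset.sum_image fun a _ b _ h => Nat.eq_of_mul_eq_mul_left hp.pos h, ← Finset.sum_add_distrib]

end Fibre

/-! ## §2 Closed forms: one, a prime, two primes, FOUR primes -/

section ClosedForms

/-- `decompositions 1 = {∅}` (the empty decomposition). [cite: TianYuanZhang2017, Thm. 1.1 (decompositions, dᵢ > 1)] -/
theorem decompositions_one : decompositions 1 = {∅} := by
  ext D
  rw [Finset.mem_singleton, mem_decompositions_iff, Nat.divisors_one]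
  constructor
  · rintro ⟨hsub, h1, -, -⟩
    exact Finset.eq_empty_of_forall_notMem fun d hd =>
      (h1 d hd).ne' (Finset.mem_singleton.mp (hsub hd))
  · rintro rfl
    simp

-- `decompositions_prime : decompositions p = {{p}}` is LANDED (p2-typer GEN 4,
-- `P2/CongruentNumberPairsAtTwoPrimeSevenModEight.lean`) and reused below.

variable {M : Type*} [AddCommMonoid M]

/-- **Two primes**: the decompositions of `a·b` are `{ab}` and `{a, b}`.
[cite: TianYuanZhang2017, Thm. 1.1 (decompositions)] [cite: HardyWright2008, §1.3 Thm. 2] -/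
theorem sum_decompositions_two {a b : ℕ} (ha : a.Prime) (hb : b.Prime) (hab : a ≠ b)
    (F : Finset ℕ → M) : ∑ D ∈ decompositions (a * b), F D = F {a * b} + F {a, b} := by
  have hsq : Squarefree (a * b) :=
    Nat.squarefree_mul_iff.mpr ⟨(Nat.coprime_primes ha hb).mpr hab, ha.prime.squarefree,
      hb.prime.squarefree⟩
  rw [sum_decompositions_fibre hsq ha (dvd_mul_right a b) F, Nat.mul_div_cancel_left b ha.pos,
    Nat.Prime.divisors hb, Finset.sum_pair hb.one_lt.ne, mul_one, Nat.mul_div_cancel_left b ha.pos,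
    decompositions_prime hb, Finset.sum_singleton, Nat.div_self (Nat.mul_pos ha.pos hb.pos),
    decompositions_one, Finset.sum_singleton, Finset.insert_empty, add_comm]

/-- A prime does not divide the product of two primes different from it. [cite: HardyWright2008, §1.3 Thm. 2] -/
theorem not_dvd_mul_of_prime_ne {p a b : ℕ} (hp : p.Prime) (ha : a.Prime) (hb : b.Prime)
    (hpa : p ≠ a) (hpb : p ≠ b) : ¬ p ∣ a * b := by
  intro h
  rcases (Nat.Prime.dvd_mul hp).mp h with h | h
  · exact hpa ((Nat.prime_dvd_prime_iff_eq hp ha).mp h)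
  · exact hpb ((Nat.prime_dvd_prime_iff_eq hp hb).mp h)

/-- **FOUR distinct primes `q, a, b, c`: the FIFTEEN decompositions of `q·a·b·c`** — one with one
block, seven with two, six with three, one with four — as a sum identity; obtained from the fibre of `q`
(`e ∣ abc`, eight divisors) and the landed three / two / one-prime closed forms. With `q = 2` this is
the bookkeeping of the even three-prime genus sums `Σ(2p₀p₁p₂)`.
[cite: TianYuanZhang2017, Thm. 1.1 / Thm. 1.2 (sums over non-ordered decompositions)] [cite: HardyWright2008, §1.3 Thm. 2] -/
theorem sum_decompositions_four {q a b c : ℕ} (hq : q.Prime) (ha : a.Prime) (hb : b.Prime)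
    (hc : c.Prime) (hqa : q ≠ a) (hqb : q ≠ b) (hqc : q ≠ c) (hab : a ≠ b) (hac : a ≠ c)
    (hbc : b ≠ c) (F : Finset ℕ → M) :
    ∑ D ∈ decompositions (q * a * b * c), F D =
      F {q * a * b * c}
      + F {q, a * b * c} + F {q, a, b * c} + F {q, b, a * c} + F {q, c, a * b} + F {q, a, b, c}
      + F {q * a, b * c} + F {q * a, b, c}
      + F {q * b, a * c} + F {q * b, a, c}
      + F {q * c, a * b} + F {q * c, a, b}
      + F {q * b * c, a} + F {q * a * c, b} + F {q * a * b, c} := by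
  -- coprimality / square-freeness of the four primes
  have cqa : Nat.Coprime q a := (Nat.coprime_primes hq ha).mpr hqa
  have cqb : Nat.Coprime q b := (Nat.coprime_primes hq hb).mpr hqb
  have cqc : Nat.Coprime q c := (Nat.coprime_primes hq hc).mpr hqc
  have cab : Nat.Coprime a b := (Nat.coprime_primes ha hb).mpr hab
  have cac : Nat.Coprime a c := (Nat.coprime_primes ha hc).mpr hac
  have cbc : Nat.Coprime b c := (Nat.coprime_primes hb hc).mpr hbc
  have hsq : Squarefree (q * a * b * c) :=
    Nat.squarefree_mul_iff.mpr ⟨(cqc.mul_left cac).mul_left cbc,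
      Nat.squarefree_mul_iff.mpr ⟨cqb.mul_left cab,
        Nat.squarefree_mul_iff.mpr ⟨cqa, hq.prime.squarefree, ha.prime.squarefree⟩,
        hb.prime.squarefree⟩, hc.prime.squarefree⟩
  have hqn : q ∣ q * a * b * c := ((dvd_mul_right q a).mul_right b).mul_right c
  -- the eight quotients `qabc / (q e)`, `e ∣ abc`
  have hq0 := hq.pos
  have ha0 := ha.pos
  have hb0 := hb.pos
  have hc0 := hc.pos
  have d0 : q * a * b * c / q = a * (b * c) :=
    Nat.div_eq_of_eq_mul_left hq0 (by ring)
  have d0' : q * a * b * c / q = a * b * c :=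
    Nat.div_eq_of_eq_mul_left hq0 (by ring)
  have d1 : q * a * b * c / (q * c) = a * b :=
    Nat.div_eq_of_eq_mul_left (Nat.mul_pos hq0 hc0) (by ring)
  have d2 : q * a * b * c / (q * b) = a * c :=
    Nat.div_eq_of_eq_mul_left (Nat.mul_pos hq0 hb0) (by ring)
  have d3 : q * a * b * c / (q * (b * c)) = a :=
    Nat.div_eq_of_eq_mul_left (Nat.mul_pos hq0 (Nat.mul_pos hb0 hc0)) (by ring)
  have d4 : q * a * b * c / (q * a) = b * c :=
    Nat.div_eq_of_eq_mul_left (Nat.mul_pos hq0 ha0) (by ring)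
  have d5 : q * a * b * c / (q * (a * c)) = b :=
    Nat.div_eq_of_eq_mul_left (Nat.mul_pos hq0 (Nat.mul_pos ha0 hc0)) (by ring)
  have d6 : q * a * b * c / (q * (a * b)) = c :=
    Nat.div_eq_of_eq_mul_left (Nat.mul_pos hq0 (Nat.mul_pos ha0 hb0)) (by ring)
  have d7 : q * a * b * c / (q * (a * (b * c))) = 1 :=
    Nat.div_eq_of_eq_mul_left (Nat.mul_pos hq0 (Nat.mul_pos ha0 (Nat.mul_pos hb0 hc0))) (by ring)
  rw [sum_decompositions_fibre hsq hq hqn F, d0,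
    sum_divisors_prime_mul ha (not_dvd_mul_of_prime_ne ha hb hc hab hac) (Nat.mul_ne_zero hb.ne_zero hc.ne_zero),
    sum_divisors_prime_mul hb (fun h => hbc ((Nat.prime_dvd_prime_iff_eq hb hc).mp h)) hc.ne_zero,
    Nat.Prime.divisors hc, Finset.sum_pair hc.one_lt.ne]
  simp only [mul_one]
  rw [d0', d1, d2, d3, d4, d5, d6, d7,
    sum_decompositions_three ha hb hc hab hac hbc, sum_decompositions_two ha hb hab,
    sum_decompositions_two ha hc hac, sum_decompositions_two hb hc hbc, decompositions_prime ha,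
    decompositions_prime hb, decompositions_prime hc, decompositions_one]
  simp only [Finset.sum_singleton, Finset.insert_empty]
  rw [show a * (b * c) = a * b * c from (mul_assoc a b c).symm,
    show q * (b * c) = q * b * c from (mul_assoc q b c).symm,
    show q * (a * c) = q * a * c from (mul_assoc q a c).symm,
    show q * (a * b) = q * a * b from (mul_assoc q a b).symm,
    show q * (a * b * c) = q * a * b * c by ring]
  abel

end ClosedForms

end Summit.BirchSwinnertonDyer.Rank1Residual.P2
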